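import Summits.QuantumFields.YangMills.Theorems.BalabanUVNodesN15KingModelFullPropagatorMixedRateSlice
import Summits.QuantumFields.YangMills.Theorems.BalabanUVNodesN15KingModelFullPropagatorGradRateProfile

/-!
# BalabanUVNodes ∕ N15 — THE KING-MODEL RUNG, CURVED EDITION (PART Φ-b): THE TWO-SPACING η-RATE PROFILE OF THE MIXED SECOND DIFFERENCE
# `DD_{μν}G^η_K = (L^K)²δ^{(1)}_μδ^{(2)}_νG^η_K` OF KING'S FULL `A = 0` FLUCTUATION PROPAGATOR, ALL PAIRS — King's (3.73) with `|a| = |b| = 1`, SUMMED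
# over (2.17): paired levels carry the rate AT THEIR OWN SCALE, the `n` unpaired fine levels in full — UNIFORMLY in `K`, `n`, the volume and the mass
# (Track A, DAG node N15 = NE2; FAN-OUT v1.1 §N15 s3 «KING-MODEL RUNG … + the one-line statement of what the curved case adds»)

HONEST FRAMING.  Count-neutral kernel bookkeeping (cell `pub-ymgap`, seat `pub-ymgap-dag-n15-e` g10; `--supports stmt-QuantumFields-20544 --as helper` = K3⁷
`SpineGivenEndpointR13SepCoPH`, WORDS-143).  TEMPLATE LITERATURE, `A = 0`: C. King's scalar U(1)-Higgs MODEL on finite tori ([King1986] §2.2 (2.13)–(2.17)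
p. 653, (2.20) p. 654, Prop. 3.7 (3.63) p. 663, Prop. 3.9 (3.73) p. 665 «`|D^a_{x′}D^b_{y′}G^{η′}_{(j)}(x′, y′) − D^a_xD^b_yG^η_{(j)}(x, y)| ≤ C(L^{−γk})(L^jη)^{2−d−|a|−|b|−γ}
exp[−δ₀(L^jη)^{−1}|x − y|]`», (4.42)–(4.43) p. 675), NOT Bałaban's covariant objects.  The statement below is the `|a| = |b| = 1` clause of (3.73) SUMMED
over the slices (2.17) of the FULL propagator — the mixed-derivative twin of parts S-a (`(0,0)`), S-c (`(1,0)`), S-d v1.1 (`(0,1)`); it is the KERNEL of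
[B9]'s (3.44)∕(3.45) objects `∇_UG∇*_U` at `U ≡ 1`, compared at two spacings.  Decided in the MODEL; NOT a printed proposition (a (2.17)-summed SHAPE);
NE2⁺ is NOT PRINTED and not proved here; NOT a node discharge; nothing continuum ∕ ℝ⁴ ∕ OS ∕ mass-gap ∕ Clay.  0 `sorry`, 0 `def`, standard axioms.

THE RESULT (`0 ≤ γ < 1`, `θ = L^{−γ∕2}`, `ΛL² = (L^{d+1}∕L²)·L·L = L^{d+1}`, `N′ = L^nL^K`, `r′ = |x′ − y′|`, `x = πx′`, `y = πy′`):
`|DD′_{μν}G′(x′, y′) − DD_{μν}G(x, y)| ≤ C·[θ^K·Σ_{i<K}(ΛL²·L^{γ∕2})^i·e^{−δr′L^i∕N′} + Σ_{i<n}(ΛL²)^{K+i}·e^{−δr′L^{K+i}∕N′}]` for ALL pairs.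
PAIRED INDUCTION ON `K` (the method of parts O-b ∕ S-a ∕ S-c, one more derivative): the step peels the top slice of BOTH runs (§1 `fullPropDD_peel_fine` +
part V-a `fullPropDD_peel`: per-level factor `ΛL²`, fine distance preserved, `tdistT_flatten`), the sub-pair is the induction hypothesis on the finer cube at mass
`m²∕L²`, the slice pair is part Φ-a `ksDDSlice_rate_unif` (`Cr·θ^K·e^{−κ|B_sub(x)−B_sub(y)|}`, block distance one level down `≥ r′∕(L^nL^K) − 1`); the base
`K = 1` is part V-a `fullPropDD_profile_unif` for BOTH runs (the coarse single level read in fine distance by S-a `tdistT_le_mul_underPtN`).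
* §1 `fullPropDD_peel_fine`, `fullPropDD_peel_pair_abs_le`; §2 ★★ **`fullPropDD_rateProfile_unif`**.
WHAT THE CURVED CASE ADDS (one line): the same two-spacing profile for `∇_UG_k(U)∇*_U` uniformly over `Reg335` — not printed ([B9] prints η-uniformity).
HONEST SCOPE.  (i) `A = 0`, periodic b.c., odd `L ≥ 3`, `0 < m² ≤ m₀²`, cubes `2L^e`, `K, n ≥ 1`; (ii) lattice units; sup torus distance; King's pairing
`underPtN`; forward η-differences in both variables; (iii) `0 ≤ γ < 1`; (iv) not Bałaban's `G_k(U)`; not a discharge.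
Locators: [King1986] (2.13)–(2.17) p. 653, (2.20) p. 654, Prop. 3.7 (3.63) p. 663, Prop. 3.8 (3.71) p. 664, Prop. 3.9 (3.73) p. 665, (4.42)–(4.43) p. 675.
-/

noncomputable section

namespace Summit.QuantumFields.YangMills.BalabanUVNodes.N15KingModelRung.Curved

open Real Finset Matrix
open Literature.MathematicalPhysics.QuantumFieldTheory.Balaban1983to89.B5Prop11Plancherel (Tor fine unitVec)
open Literature.MathematicalPhysics.QuantumFieldTheory.King1986 (aK aK_pos)
open Literature.MathematicalPhysics.QuantumFieldTheory.King1986.Torus (constrainedProp flatten blockOf tdistT torCongr torCongr_add torCongr_unitVec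
  flatten_add flatten_unitVec tdistT_torCongr blockOf_flatten tdistT_nonneg)

variable {d : ℕ} (L : ℕ) [NeZero L]

/-! ## §1 The doubly differentiated peel of the fine run and the pair of peels -/

/-- **THE DOUBLY DIFFERENTIATED PEEL OF THE FINE RUN**: for the slice index `i = (e, K = i.j, n = i.n, …)`, `a > 0`, `m² > 0`, `L ≥ 2`, directions `μ, ν`,
fine points `x′, y′` of the nested torus and the spelling bridge `h`:
`DD_{μν}G(K+1+n, M_e, m²)(e(flatten x′), e(flatten y′)) = (L^{d+1}∕L²)·L·L·[DD_{μν}G(K+n, fine L M_e, m²∕L²)(x′, y′) + Σ_w(Σ_z ∂′ℋ′_μ(x′,z)C′(z,w))∂′ℋ′_ν(y′,w)]`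
— part O-b′ `fullPropD_peel_fine` at the two source points `y′ + e_ν`, `y′` (the re-indexed ∕ flattened lattice step is the nested step) and part Φ-a `ksDDSlice'_eq`.
[cite: King1986, (2.17) p.653, (2.20) p.654, (4.42) p.675, Prop. 3.9 (3.73) p.665 (object)] -/
theorem fullPropDD_peel_fine (hL : 2 ≤ L) {a msq : ℝ} (ha : 0 < a) (hm : 0 < msq) (i : KSliceIdx d) (μ ν : Fin (d + 1))
    (x' y' : Tor (fine (L ^ i.n * L ^ i.j) (ksU L i)))
    (h : ∀ ρ, fine (L ^ i.n * L ^ i.j * L) (ksM L i) ρ = fine (L ^ i.n * L ^ (i.j + 1)) (ksM L i) ρ) :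
    ((L ^ i.n * L ^ (i.j + 1) : ℕ) : ℝ) * (((L ^ i.n * L ^ (i.j + 1) : ℕ) : ℝ) *
        (constrainedProp (L ^ i.n * L ^ (i.j + 1)) (ksM L i) (aK a L (i.j + 1 + i.n)) (((L ^ i.n * L ^ (i.j + 1) : ℕ) : ℝ) ^ 2) msq
            (torCongr h (flatten (L ^ i.n * L ^ i.j) L (ksM L i) x') + unitVec (fine (L ^ i.n * L ^ (i.j + 1)) (ksM L i)) μ)
            (torCongr h (flatten (L ^ i.n * L ^ i.j) L (ksM L i) y') + unitVec (fine (L ^ i.n * L ^ (i.j + 1)) (ksM L i)) ν)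
          - constrainedProp (L ^ i.n * L ^ (i.j + 1)) (ksM L i) (aK a L (i.j + 1 + i.n)) (((L ^ i.n * L ^ (i.j + 1) : ℕ) : ℝ) ^ 2) msq
            (torCongr h (flatten (L ^ i.n * L ^ i.j) L (ksM L i) x'))
            (torCongr h (flatten (L ^ i.n * L ^ i.j) L (ksM L i) y') + unitVec (fine (L ^ i.n * L ^ (i.j + 1)) (ksM L i)) ν))
      - ((L ^ i.n * L ^ (i.j + 1) : ℕ) : ℝ) *
        (constrainedProp (L ^ i.n * L ^ (i.j + 1)) (ksM L i) (aK a L (i.j + 1 + i.n)) (((L ^ i.n * L ^ (i.j + 1) : ℕ) : ℝ) ^ 2) msq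
            (torCongr h (flatten (L ^ i.n * L ^ i.j) L (ksM L i) x') + unitVec (fine (L ^ i.n * L ^ (i.j + 1)) (ksM L i)) μ)
            (torCongr h (flatten (L ^ i.n * L ^ i.j) L (ksM L i) y'))
          - constrainedProp (L ^ i.n * L ^ (i.j + 1)) (ksM L i) (aK a L (i.j + 1 + i.n)) (((L ^ i.n * L ^ (i.j + 1) : ℕ) : ℝ) ^ 2) msq
            (torCongr h (flatten (L ^ i.n * L ^ i.j) L (ksM L i) x')) (torCongr h (flatten (L ^ i.n * L ^ i.j) L (ksM L i) y'))))
      = (L : ℝ) ^ (d + 1) / (L : ℝ) ^ 2 * L * L *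
          (((L ^ i.n * L ^ i.j : ℕ) : ℝ) * (((L ^ i.n * L ^ i.j : ℕ) : ℝ) *
              (constrainedProp (L ^ i.n * L ^ i.j) (ksU L i) (aK a L (i.j + i.n)) (((L ^ i.n * L ^ i.j : ℕ) : ℝ) ^ 2) (msq / (L : ℝ) ^ 2)
                  (x' + unitVec (fine (L ^ i.n * L ^ i.j) (ksU L i)) μ) (y' + unitVec (fine (L ^ i.n * L ^ i.j) (ksU L i)) ν)
                - constrainedProp (L ^ i.n * L ^ i.j) (ksU L i) (aK a L (i.j + i.n)) (((L ^ i.n * L ^ i.j : ℕ) : ℝ) ^ 2) (msq / (L : ℝ) ^ 2)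
                  x' (y' + unitVec (fine (L ^ i.n * L ^ i.j) (ksU L i)) ν))
            - ((L ^ i.n * L ^ i.j : ℕ) : ℝ) *
              (constrainedProp (L ^ i.n * L ^ i.j) (ksU L i) (aK a L (i.j + i.n)) (((L ^ i.n * L ^ i.j : ℕ) : ℝ) ^ 2) (msq / (L : ℝ) ^ 2)
                  (x' + unitVec (fine (L ^ i.n * L ^ i.j) (ksU L i)) μ) y'
                - constrainedProp (L ^ i.n * L ^ i.j) (ksU L i) (aK a L (i.j + i.n)) (((L ^ i.n * L ^ i.j : ℕ) : ℝ) ^ 2) (msq / (L : ℝ) ^ 2) x' y'))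
            + triple (ksDH' L a (msq / (L : ℝ) ^ 2) i μ x') (ksC' L a (msq / (L : ℝ) ^ 2) i)
                (ksDH' L a (msq / (L : ℝ) ^ 2) i ν y')) := by
  rw [← torCongr_unitVec h ν, ← torCongr_add, ← flatten_unitVec (L ^ i.n * L ^ i.j) L (ksM L i) ν, ← flatten_add,
    fullPropD_peel_fine L hL ha hm i μ x' (y' + _) h, fullPropD_peel_fine L hL ha hm i μ x' y' h, ← ksDDSlice'_eq]
  push_cast
  ring

/-- **The difference of the two doubly differentiated peels, triangle-inequality form**: at the same index and mass,
`|DD′G(K+1+n)(e x̂′, e ŷ′) − DDG(K+1)(x̂, ŷ)| ≤ (L^{d+1}∕L²)·L·L·(|DD′G(K+n)^{sub}(x′, y′) − DDG(K)^{sub}(x, y)| + |slice′ pair − slice pair|)`.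
[cite: King1986, (2.17) p.653, (4.42)–(4.43) p.675] -/
theorem fullPropDD_peel_pair_abs_le (hL : 2 ≤ L) {a msq : ℝ} (ha : 0 < a) (hm : 0 < msq) (i : KSliceIdx d) (μ ν : Fin (d + 1))
    (x' y' : Tor (fine (L ^ i.n * L ^ i.j) (ksU L i))) (x y : Tor (fine (L ^ i.j) (ksU L i)))
    (h : ∀ ρ, fine (L ^ i.n * L ^ i.j * L) (ksM L i) ρ = fine (L ^ i.n * L ^ (i.j + 1)) (ksM L i) ρ) :
    |((L ^ i.n * L ^ (i.j + 1) : ℕ) : ℝ) * (((L ^ i.n * L ^ (i.j + 1) : ℕ) : ℝ) *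
          (constrainedProp (L ^ i.n * L ^ (i.j + 1)) (ksM L i) (aK a L (i.j + 1 + i.n)) (((L ^ i.n * L ^ (i.j + 1) : ℕ) : ℝ) ^ 2) msq
              (torCongr h (flatten (L ^ i.n * L ^ i.j) L (ksM L i) x') + unitVec (fine (L ^ i.n * L ^ (i.j + 1)) (ksM L i)) μ)
              (torCongr h (flatten (L ^ i.n * L ^ i.j) L (ksM L i) y') + unitVec (fine (L ^ i.n * L ^ (i.j + 1)) (ksM L i)) ν)
            - constrainedProp (L ^ i.n * L ^ (i.j + 1)) (ksM L i) (aK a L (i.j + 1 + i.n)) (((L ^ i.n * L ^ (i.j + 1) : ℕ) : ℝ) ^ 2) msq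
              (torCongr h (flatten (L ^ i.n * L ^ i.j) L (ksM L i) x'))
              (torCongr h (flatten (L ^ i.n * L ^ i.j) L (ksM L i) y') + unitVec (fine (L ^ i.n * L ^ (i.j + 1)) (ksM L i)) ν))
        - ((L ^ i.n * L ^ (i.j + 1) : ℕ) : ℝ) *
          (constrainedProp (L ^ i.n * L ^ (i.j + 1)) (ksM L i) (aK a L (i.j + 1 + i.n)) (((L ^ i.n * L ^ (i.j + 1) : ℕ) : ℝ) ^ 2) msq
              (torCongr h (flatten (L ^ i.n * L ^ i.j) L (ksM L i) x') + unitVec (fine (L ^ i.n * L ^ (i.j + 1)) (ksM L i)) μ)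
              (torCongr h (flatten (L ^ i.n * L ^ i.j) L (ksM L i) y'))
            - constrainedProp (L ^ i.n * L ^ (i.j + 1)) (ksM L i) (aK a L (i.j + 1 + i.n)) (((L ^ i.n * L ^ (i.j + 1) : ℕ) : ℝ) ^ 2) msq
              (torCongr h (flatten (L ^ i.n * L ^ i.j) L (ksM L i) x')) (torCongr h (flatten (L ^ i.n * L ^ i.j) L (ksM L i) y'))))
      - ((L ^ i.j * L : ℕ) : ℝ) * (((L ^ i.j * L : ℕ) : ℝ) *
          (constrainedProp (L ^ i.j * L) (ksM L i) (aK a L (i.j + 1)) (((L ^ i.j * L : ℕ) : ℝ) ^ 2) msq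
              (flatten (L ^ i.j) L (ksM L i) x + unitVec (fine (L ^ i.j * L) (ksM L i)) μ)
              (flatten (L ^ i.j) L (ksM L i) y + unitVec (fine (L ^ i.j * L) (ksM L i)) ν)
            - constrainedProp (L ^ i.j * L) (ksM L i) (aK a L (i.j + 1)) (((L ^ i.j * L : ℕ) : ℝ) ^ 2) msq
              (flatten (L ^ i.j) L (ksM L i) x) (flatten (L ^ i.j) L (ksM L i) y + unitVec (fine (L ^ i.j * L) (ksM L i)) ν))
        - ((L ^ i.j * L : ℕ) : ℝ) *
          (constrainedProp (L ^ i.j * L) (ksM L i) (aK a L (i.j + 1)) (((L ^ i.j * L : ℕ) : ℝ) ^ 2) msq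
              (flatten (L ^ i.j) L (ksM L i) x + unitVec (fine (L ^ i.j * L) (ksM L i)) μ) (flatten (L ^ i.j) L (ksM L i) y)
            - constrainedProp (L ^ i.j * L) (ksM L i) (aK a L (i.j + 1)) (((L ^ i.j * L : ℕ) : ℝ) ^ 2) msq
              (flatten (L ^ i.j) L (ksM L i) x) (flatten (L ^ i.j) L (ksM L i) y)))|
      ≤ (L : ℝ) ^ (d + 1) / (L : ℝ) ^ 2 * L * L *
          (|((L ^ i.n * L ^ i.j : ℕ) : ℝ) * (((L ^ i.n * L ^ i.j : ℕ) : ℝ) *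
                (constrainedProp (L ^ i.n * L ^ i.j) (ksU L i) (aK a L (i.j + i.n)) (((L ^ i.n * L ^ i.j : ℕ) : ℝ) ^ 2) (msq / (L : ℝ) ^ 2)
                    (x' + unitVec (fine (L ^ i.n * L ^ i.j) (ksU L i)) μ) (y' + unitVec (fine (L ^ i.n * L ^ i.j) (ksU L i)) ν)
                  - constrainedProp (L ^ i.n * L ^ i.j) (ksU L i) (aK a L (i.j + i.n)) (((L ^ i.n * L ^ i.j : ℕ) : ℝ) ^ 2) (msq / (L : ℝ) ^ 2)
                    x' (y' + unitVec (fine (L ^ i.n * L ^ i.j) (ksU L i)) ν))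
              - ((L ^ i.n * L ^ i.j : ℕ) : ℝ) *
                (constrainedProp (L ^ i.n * L ^ i.j) (ksU L i) (aK a L (i.j + i.n)) (((L ^ i.n * L ^ i.j : ℕ) : ℝ) ^ 2) (msq / (L : ℝ) ^ 2)
                    (x' + unitVec (fine (L ^ i.n * L ^ i.j) (ksU L i)) μ) y'
                  - constrainedProp (L ^ i.n * L ^ i.j) (ksU L i) (aK a L (i.j + i.n)) (((L ^ i.n * L ^ i.j : ℕ) : ℝ) ^ 2) (msq / (L : ℝ) ^ 2) x' y'))
            - ((L ^ i.j : ℕ) : ℝ) * (((L ^ i.j : ℕ) : ℝ) *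
                (constrainedProp (L ^ i.j) (ksU L i) (aK a L i.j) (((L ^ i.j : ℕ) : ℝ) ^ 2) (msq / (L : ℝ) ^ 2)
                    (x + unitVec (fine (L ^ i.j) (ksU L i)) μ) (y + unitVec (fine (L ^ i.j) (ksU L i)) ν)
                  - constrainedProp (L ^ i.j) (ksU L i) (aK a L i.j) (((L ^ i.j : ℕ) : ℝ) ^ 2) (msq / (L : ℝ) ^ 2)
                    x (y + unitVec (fine (L ^ i.j) (ksU L i)) ν))
              - ((L ^ i.j : ℕ) : ℝ) *
                (constrainedProp (L ^ i.j) (ksU L i) (aK a L i.j) (((L ^ i.j : ℕ) : ℝ) ^ 2) (msq / (L : ℝ) ^ 2)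
                    (x + unitVec (fine (L ^ i.j) (ksU L i)) μ) y
                  - constrainedProp (L ^ i.j) (ksU L i) (aK a L i.j) (((L ^ i.j : ℕ) : ℝ) ^ 2) (msq / (L : ℝ) ^ 2) x y))|
            + |triple (ksDH' L a (msq / (L : ℝ) ^ 2) i μ x') (ksC' L a (msq / (L : ℝ) ^ 2) i) (ksDH' L a (msq / (L : ℝ) ^ 2) i ν y')
                - triple (ksDH L a (msq / (L : ℝ) ^ 2) i μ x) (ksC L a (msq / (L : ℝ) ^ 2) i) (ksDH L a (msq / (L : ℝ) ^ 2) i ν y)|) := by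
  have hΛ : 0 ≤ (L : ℝ) ^ (d + 1) / (L : ℝ) ^ 2 * L * L := by positivity
  rw [fullPropDD_peel_fine L hL ha hm i μ ν x' y' h, fullPropDD_peel L hL ha hm i μ ν x y, ← mul_sub, abs_mul, abs_of_nonneg hΛ]
  refine mul_le_mul_of_nonneg_left ?_ hΛ
  have e : ∀ (p q r s : ℝ), p + q - (r + s) = (p - r) + (q - s) := fun p q r s => by ring
  rw [e]
  exact abs_add_le _ _

/-! ## §2 The two-spacing rate profile of the mixed second difference, all pairs -/

set_option maxHeartbeats 400000 in
/-- ★★ **THE TWO-SPACING η-RATE PROFILE OF THE MIXED SECOND DIFFERENCE OF KING'S FULL `A = 0` FLUCTUATION PROPAGATOR, ALL PAIRS** (Prop. 3.9 (3.73) with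
`|a| = |b| = 1`, summed over (2.17)): for odd `L ≥ 3`, `a > 0`, a mass cap `m₀² ≥ 0` and `0 ≤ γ < 1` there are `C, δ > 0` (functions of `d, L, a, m₀², γ`)
such that for EVERY `K ≥ 1`, `n ≥ 1`, cube `M_μ = 2L^e`, mass `0 < m² ≤ m₀²`, directions `μ, ν` and ALL fine points `x′, y′` of the `(K+n)`-level run
(`x = underPtN x′`, `y = underPtN y′`, `r′ = |x′ − y′|`, `N′ = L^nL^K`, `ΛL² = (L^{d+1}∕L²)·L·L`, `θ = L^{−γ∕2}`):
`|N′(N′[G′(x′+e_μ, y′+e_ν) − G′(x′, y′+e_ν)] − N′[G′(x′+e_μ, y′) − G′(x′, y′)]) − L^K(L^K[G(x+e_μ, y+e_ν) − G(x, y+e_ν)] − L^K[G(x+e_μ, y) − G(x, y)])|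
 ≤ C·[θ^K·Σ_{i<K}(ΛL²·L^{γ∕2})^i·exp(−δ·r′·L^i∕N′) + Σ_{i<n}(ΛL²)^{K+i}·exp(−δ·r′·L^{K+i}∕N′)]`.  Paired induction on `K` (module docstring).
[cite: King1986, (2.13)–(2.17) p.653, (2.20) p.654, Prop. 3.7 (3.63) p.663, Prop. 3.8 (3.71) p.664, Prop. 3.9 (3.73) p.665, (4.42)–(4.43) p.675] -/
theorem fullPropDD_rateProfile_unif (hLodd : Odd L) (hL : 2 ≤ L) {a : ℝ} (ha : 0 < a) {m0sq : ℝ} (hm0 : 0 ≤ m0sq) {γ : ℝ}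
    (hγ0 : 0 ≤ γ) (hγ1 : γ < 1) :
    ∃ C δ : ℝ, 0 < C ∧ 0 < δ ∧ ∀ (K : ℕ), 1 ≤ K → ∀ (n : ℕ), 1 ≤ n →
      ∀ (e : ℕ) (M : Fin (d + 1) → ℕ) [∀ μ, NeZero (M μ)], (∀ μ, M μ = 2 * L ^ e) →
      ∀ (msq : ℝ), 0 < msq → msq ≤ m0sq →
      ∀ (μ ν : Fin (d + 1)) (x' y' : Tor (fine (L ^ n * L ^ K) M)),
        |((L ^ n * L ^ K : ℕ) : ℝ) * (((L ^ n * L ^ K : ℕ) : ℝ) *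
              (constrainedProp (L ^ n * L ^ K) M (aK a L (K + n)) (((L ^ n * L ^ K : ℕ) : ℝ) ^ 2) msq
                  (x' + unitVec (fine (L ^ n * L ^ K) M) μ) (y' + unitVec (fine (L ^ n * L ^ K) M) ν)
                - constrainedProp (L ^ n * L ^ K) M (aK a L (K + n)) (((L ^ n * L ^ K : ℕ) : ℝ) ^ 2) msq
                  x' (y' + unitVec (fine (L ^ n * L ^ K) M) ν))
            - ((L ^ n * L ^ K : ℕ) : ℝ) *
              (constrainedProp (L ^ n * L ^ K) M (aK a L (K + n)) (((L ^ n * L ^ K : ℕ) : ℝ) ^ 2) msq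
                  (x' + unitVec (fine (L ^ n * L ^ K) M) μ) y'
                - constrainedProp (L ^ n * L ^ K) M (aK a L (K + n)) (((L ^ n * L ^ K : ℕ) : ℝ) ^ 2) msq x' y'))
          - ((L ^ K : ℕ) : ℝ) * (((L ^ K : ℕ) : ℝ) *
              (constrainedProp (L ^ K) M (aK a L K) (((L ^ K : ℕ) : ℝ) ^ 2) msq
                  (underPtN L K n M x' + unitVec (fine (L ^ K) M) μ) (underPtN L K n M y' + unitVec (fine (L ^ K) M) ν)
                - constrainedProp (L ^ K) M (aK a L K) (((L ^ K : ℕ) : ℝ) ^ 2) msq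
                  (underPtN L K n M x') (underPtN L K n M y' + unitVec (fine (L ^ K) M) ν))
            - ((L ^ K : ℕ) : ℝ) *
              (constrainedProp (L ^ K) M (aK a L K) (((L ^ K : ℕ) : ℝ) ^ 2) msq
                  (underPtN L K n M x' + unitVec (fine (L ^ K) M) μ) (underPtN L K n M y')
                - constrainedProp (L ^ K) M (aK a L K) (((L ^ K : ℕ) : ℝ) ^ 2) msq (underPtN L K n M x') (underPtN L K n M y')))|
          ≤ C * ((((L : ℝ) ^ (-(γ / 2))) ^ K)
                  * ∑ i ∈ Finset.range K, ((L : ℝ) ^ (d + 1) / (L : ℝ) ^ 2 * L * L * (L : ℝ) ^ (γ / 2)) ^ i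
                      * Real.exp (-(δ * (tdistT (fine (L ^ n * L ^ K) M) x' y' * (L : ℝ) ^ i / ((L ^ n * L ^ K : ℕ) : ℝ))))
                + ∑ i ∈ Finset.range n, ((L : ℝ) ^ (d + 1) / (L : ℝ) ^ 2 * L * L) ^ (K + i)
                      * Real.exp (-(δ * (tdistT (fine (L ^ n * L ^ K) M) x' y' * (L : ℝ) ^ (K + i)
                          / ((L ^ n * L ^ K : ℕ) : ℝ))))) := by
  have hL1 : 1 < L := by omega
  have hL1n : 1 ≤ L := hL1.le
  have hLr : (1 : ℝ) ≤ L := by exact_mod_cast hL1n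
  have hL0 : (0 : ℝ) < L := by positivity
  -- the rate `θ = L^{−γ∕2} ∈ [L⁻¹, 1]` and its inverse `L^{γ∕2}`
  set θ : ℝ := (L : ℝ) ^ (-(γ / 2)) with hθdef
  set φ : ℝ := (L : ℝ) ^ (γ / 2) with hφdef
  have hθ0 : 0 < θ := Real.rpow_pos_of_pos hL0 _
  have hφ0 : 0 < φ := Real.rpow_pos_of_pos hL0 _
  have hθφ : θ * φ = 1 := theta_mul_rpow L hL1n γ
  have hθL : (L : ℝ)⁻¹ ≤ θ := inv_le_theta L hL1n hγ1.le
  -- part V-a (both runs at the base) and part Φ-a's slice rate (the step)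
  obtain ⟨Ca, δa, hCa, hδa, Ha⟩ := fullPropDD_profile_unif (d := d) L hLodd hL ha hm0
  obtain ⟨Cr, κ, hCr, hκ, Hr⟩ := ksDDSlice_rate_unif (d := d) L hLodd hL ha hm0 hγ0 hγ1
  -- the constants of the theorem
  set Λ : ℝ := (L : ℝ) ^ (d + 1) / (L : ℝ) ^ 2 * L * L with hΛdef
  have hΛ : 0 < Λ := by positivity
  set Λ' : ℝ := Λ * φ with hΛ'def
  have hΛ' : 0 < Λ' := mul_pos hΛ hφ0
  have hθΛ' : θ * Λ' = Λ := by
    rw [hΛ'def, mul_left_comm, hθφ, mul_one]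
  set δ : ℝ := min δa κ with hδdef
  have hδ : 0 < δ := lt_min hδa hκ
  have hδa' : δ ≤ δa := min_le_left _ _
  have hδκ : δ ≤ κ := min_le_right _ _
  set C : ℝ := max (max (Ca * (1 + Real.exp δa) * L) Ca) (Λ * Cr * Real.exp κ * L) with hCdef
  have hC : 0 < C := lt_max_of_lt_left (lt_max_of_lt_right hCa)
  have hC1 : Ca * (1 + Real.exp δa) * L ≤ C := (le_max_left _ _).trans (le_max_left _ _)
  have hC2 : Ca ≤ C := (le_max_right _ _).trans (le_max_left _ _)
  have hC3 : Λ * Cr * Real.exp κ * L ≤ C := le_max_right _ _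
  -- `X·L ≤ C ⇒ X ≤ C·θ` (the spare power `L⁻¹ ≤ θ`)
  have hspare : ∀ X : ℝ, 0 ≤ X → X * L ≤ C → X ≤ C * θ := fun X hX hXL => by
    calc X = X * L * (L : ℝ)⁻¹ := by field_simp
      _ ≤ C * θ := mul_le_mul hXL hθL (inv_pos.mpr hL0).le hC.le
  refine ⟨C, δ, hC, hδ, ?_⟩
  intro K hK
  induction K, hK using Nat.le_induction with
  | base =>
    -- `K = 1`: part V-a's profile for BOTH runs; level `0` of the fine run pairs with the coarse run's single level
    intro n hn e M _ hM msq hmsq hcap μ ν x' y'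
    set u := underPtN L 1 n M x' with hu
    set v := underPtN L 1 n M y' with hv
    have hfine := Ha (1 + n) (by omega) (L ^ n * L ^ 1) (by rw [pow_add, mul_comm]) e M hM msq hmsq hcap μ ν x' y'
    have hcoarse := Ha 1 le_rfl (L ^ 1) rfl e M hM msq hmsq hcap μ ν u v
    set r' : ℝ := tdistT (fine (L ^ n * L ^ 1) M) x' y' with hr'def
    set r : ℝ := tdistT (fine (L ^ 1) M) u v with hrdef
    set N1 : ℝ := ((L ^ n * L ^ 1 : ℕ) : ℝ) with hN1def
    have hLn1 : (1 : ℝ) ≤ ((L ^ n : ℕ) : ℝ) := by exact_mod_cast Nat.one_le_pow n L (by omega)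
    have hN1eq : N1 = ((L ^ n : ℕ) : ℝ) * L := by rw [hN1def]; push_cast; ring
    have hN1pos : 0 < N1 := by rw [hN1eq]; positivity
    have hL1c : ((L ^ 1 : ℕ) : ℝ) = L := by push_cast; ring
    have hr'0 : 0 ≤ r' := tdistT_nonneg _ x' y'
    have hr0 : 0 ≤ r := tdistT_nonneg _ u v
    -- the coarse run's single level in closed form
    have hc2 : Ca * ∑ i ∈ Finset.range 1, Λ ^ i * Real.exp (-(δa * (r * (L : ℝ) ^ i / ((L ^ 1 : ℕ) : ℝ))))
        = Ca * Real.exp (-(δa * (r / L))) := by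
      rw [Finset.sum_range_one, pow_zero, pow_zero, one_mul, mul_one, hL1c]
    have hcoarse' := hcoarse.trans hc2.le
    -- the coarse decay in the fine distance: `r′ ≤ L^n·r + (L^n − 1)` ⇒ `e^{−δa·r∕L} ≤ e^{δa}·e^{−δ·r′∕N1}`
    have hpair : r' ≤ ((L ^ n : ℕ) : ℝ) * r + (((L ^ n : ℕ) : ℝ) - 1) := tdistT_le_mul_underPtN L 1 n M x' y'
    have hexpc : Real.exp (-(δa * (r / L))) ≤ Real.exp δa * Real.exp (-(δ * (r' / N1))) := by
      rw [← Real.exp_add]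
      apply Real.exp_le_exp.mpr
      have h1 : r' / N1 ≤ r / L + 1 := by
        rw [div_le_iff₀ hN1pos, hN1eq]
        have e1 : (r / L + 1) * (((L ^ n : ℕ) : ℝ) * L) = ((L ^ n : ℕ) : ℝ) * r + ((L ^ n : ℕ) : ℝ) * L := by
          field_simp
        rw [e1]
        have e2 : ((L ^ n : ℕ) : ℝ) ≤ ((L ^ n : ℕ) : ℝ) * L := le_mul_of_one_le_right (by positivity) hLr
        linarith
      have h2 : δ * (r' / N1) ≤ δa * (r' / N1) := mul_le_mul_of_nonneg_right hδa' (div_nonneg hr'0 hN1pos.le)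
      have h3 : δa * (r' / N1) ≤ δa * (r / L + 1) := mul_le_mul_of_nonneg_left h1 hδa.le
      have h4 : δa * (r / L + 1) = δa * (r / L) + δa := by ring
      linarith
    -- monotonicity `δ ≤ δa` in the fine run's exponentials
    have hmono : ∀ s : ℝ, 0 ≤ s → Real.exp (-(δa * (r' * s / N1))) ≤ Real.exp (-(δ * (r' * s / N1))) := fun s hs =>
      Real.exp_le_exp.mpr (neg_le_neg (mul_le_mul_of_nonneg_right hδa' (by positivity)))
    -- split the fine run's level sum: level `0` + levels `1 … n`
    have hsplit : ∑ i ∈ Finset.range (1 + n), Λ ^ i * Real.exp (-(δa * (r' * (L : ℝ) ^ i / N1)))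
        = Real.exp (-(δa * (r' / N1)))
          + ∑ i ∈ Finset.range n, Λ ^ (i + 1) * Real.exp (-(δa * (r' * (L : ℝ) ^ (i + 1) / N1))) := by
      rw [show 1 + n = n + 1 by omega, Finset.sum_range_succ', pow_zero, pow_zero, one_mul, mul_one, add_comm]
    have hU : ∑ i ∈ Finset.range n, Λ ^ (i + 1) * Real.exp (-(δa * (r' * (L : ℝ) ^ (i + 1) / N1)))
        ≤ ∑ i ∈ Finset.range n, Λ ^ (1 + i) * Real.exp (-(δ * (r' * (L : ℝ) ^ (1 + i) / N1))) :=
      Finset.sum_le_sum fun i _ => by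
        rw [show i + 1 = 1 + i by omega]
        exact mul_le_mul_of_nonneg_left (hmono _ (by positivity)) (pow_nonneg hΛ.le _)
    have hU0 : 0 ≤ ∑ i ∈ Finset.range n, Λ ^ (1 + i) * Real.exp (-(δ * (r' * (L : ℝ) ^ (1 + i) / N1))) :=
      Finset.sum_nonneg fun i _ => by positivity
    have h0 : Real.exp (-(δa * (r' / N1))) ≤ Real.exp (-(δ * (r' / N1))) := by
      have h := hmono 1 zero_le_one
      rwa [mul_one] at h
    -- the paired constant: `Ca·(1 + e^{δa}) ≤ C·θ`
    have hCθ : Ca * (1 + Real.exp δa) ≤ C * θ := hspare _ (by positivity) hC1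
    have hE0 : 0 ≤ Real.exp (-(δ * (r' / N1))) := (Real.exp_pos _).le
    -- the target's paired sum at `K = 1` is the single term `e^{−δ r′∕N1}`
    rw [Finset.sum_range_one, pow_zero, pow_zero, one_mul, mul_one, pow_one θ]
    refine ((abs_sub _ _).trans (add_le_add hfine hcoarse')).trans ?_
    calc Ca * ∑ i ∈ Finset.range (1 + n), Λ ^ i * Real.exp (-(δa * (r' * (L : ℝ) ^ i / N1)))
            + Ca * Real.exp (-(δa * (r / L)))
        ≤ Ca * (Real.exp (-(δ * (r' / N1)))
              + ∑ i ∈ Finset.range n, Λ ^ (1 + i) * Real.exp (-(δ * (r' * (L : ℝ) ^ (1 + i) / N1))))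
            + Ca * (Real.exp δa * Real.exp (-(δ * (r' / N1)))) := by
          rw [hsplit]
          exact add_le_add (mul_le_mul_of_nonneg_left (add_le_add h0 hU) hCa.le)
            (mul_le_mul_of_nonneg_left hexpc hCa.le)
      _ = Ca * (1 + Real.exp δa) * Real.exp (-(δ * (r' / N1)))
            + Ca * ∑ i ∈ Finset.range n, Λ ^ (1 + i) * Real.exp (-(δ * (r' * (L : ℝ) ^ (1 + i) / N1))) := by ring
      _ ≤ C * θ * Real.exp (-(δ * (r' / N1)))
            + C * ∑ i ∈ Finset.range n, Λ ^ (1 + i) * Real.exp (-(δ * (r' * (L : ℝ) ^ (1 + i) / N1))) :=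
          add_le_add (mul_le_mul_of_nonneg_right hCθ hE0) (mul_le_mul_of_nonneg_right hC2 hU0)
      _ = C * (θ * Real.exp (-(δ * (r' / N1)))
            + ∑ i ∈ Finset.range n, Λ ^ (1 + i) * Real.exp (-(δ * (r' * (L : ℝ) ^ (1 + i) / N1)))) := by ring
  | succ K hK IH =>
    intro n hn e M _ hM msq hmsq hcap μ ν x'' y''
    -- the unit lattice IS the cube `M_e`
    obtain rfl : M = fun _ => 2 * L ^ e := funext hM
    -- the slice index of the peeled top slices and the nested coordinates of the fine points
    set i : KSliceIdx d := ⟨e, K, hK, n, hn, 0, Nat.zero_le e, 1, le_rfl⟩ with hidef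
    have h : ∀ μ, fine (L ^ n * L ^ K * L) (ksM L i) μ = fine (L ^ n * L ^ (K + 1)) (ksM L i) μ :=
      fine_assoc L K n (ksM L i)
    obtain ⟨x₁, rfl⟩ := (torCongr h).surjective x''
    obtain ⟨y₁, rfl⟩ := (torCongr h).surjective y''
    obtain ⟨x', rfl⟩ := (flatten (L ^ n * L ^ K) L (ksM L i)).surjective x₁
    obtain ⟨y', rfl⟩ := (flatten (L ^ n * L ^ K) L (ksM L i)).surjective y₁
    rw [underPtN_flatten L K n (ksM L i) h x', underPtN_flatten L K n (ksM L i) h y']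
    -- the coarse points under `x′, y′` in the finer cube
    set x := underPtN L K n (ksU L i) x' with hxdef
    set y := underPtN L K n (ksU L i) y' with hydef
    -- the fine distance (preserved by both peels) and the coarse block distance one level down
    set r' : ℝ := tdistT (fine (L ^ n * L ^ K) (ksU L i)) x' y' with hr'def
    set Dsub : ℝ := tdistT (ksU L i) (blockOf (L ^ K) (ksU L i) x) (blockOf (L ^ K) (ksU L i) y) with hDsubdef
    set NK : ℝ := ((L ^ n * L ^ K : ℕ) : ℝ) with hNKdef
    have hNK1 : 1 ≤ NK := by
      rw [hNKdef]
      exact_mod_cast Nat.one_le_iff_ne_zero.mpr (Nat.mul_ne_zero (pow_ne_zero _ (by omega)) (pow_ne_zero _ (by omega)))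
    have hNK0 : 0 < NK := by linarith
    have hNKL : NK ≤ NK * L := le_mul_of_one_le_right hNK0.le hLr
    have hcastN : ((L ^ n * L ^ (K + 1) : ℕ) : ℝ) = NK * L := by rw [hNKdef]; push_cast; ring
    have hr'0 : 0 ≤ r' := tdistT_nonneg _ x' y'
    -- `Dsub` read in fine distance: `B(x) = B(x′)` one level down, then part R-a §1
    have hDsub' : Dsub = tdistT (ksU L i) (blockOf (L ^ n * L ^ K) (ksU L i) x') (blockOf (L ^ n * L ^ K) (ksU L i) y') := by
      rw [hDsubdef, hxdef, hydef, blockOf_underPtN, blockOf_underPtN]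
    have hfine : r' ≤ NK * Dsub + (NK - 1) := by
      rw [hDsub']
      exact tdistT_fine_le_blocks (L ^ n * L ^ K) (ksU L i) x' y'
    -- the mass one level down
    have hL2 : (0 : ℝ) < (L : ℝ) ^ 2 := by positivity
    have hm2 : 0 < msq / (L : ℝ) ^ 2 := div_pos hmsq hL2
    have hm2cap : msq / (L : ℝ) ^ 2 ≤ m0sq := by
      have h1 : (1 : ℝ) ≤ (L : ℝ) ^ 2 := one_le_pow₀ hLr
      exact (div_le_self hmsq.le h1).trans hcap
    -- the induction hypothesis on the finer cube `fine L M_e = (2L^{e+1})` for the sub-pair, ALL pairs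
    have hM' : ∀ μ, ksU L i μ = 2 * L ^ (e + 1) := fun μ => by
      show L * (2 * L ^ e) = 2 * L ^ (e + 1)
      ring
    have hIH := IH n hn (e + 1) (ksU L i) hM' (msq / (L : ℝ) ^ 2) hm2 hm2cap μ ν x' y'
    -- abbreviations for the level sums one level down
    set PS : ℝ := ∑ j ∈ Finset.range K, Λ' ^ j * Real.exp (-(δ * (r' * (L : ℝ) ^ j / NK))) with hPSdef
    set US : ℝ := ∑ j ∈ Finset.range n, Λ ^ (K + j) * Real.exp (-(δ * (r' * (L : ℝ) ^ (K + j) / NK))) with hUSdef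
    have hPS0 : 0 ≤ PS := Finset.sum_nonneg fun j _ => by positivity
    have hUS0 : 0 ≤ US := Finset.sum_nonneg fun j _ => by positivity
    -- part Φ-a's slice rate, read in fine distance at the NEW top scale `NK·L`
    have hS : |triple (ksDH' L a (msq / (L : ℝ) ^ 2) i μ x') (ksC' L a (msq / (L : ℝ) ^ 2) i) (ksDH' L a (msq / (L : ℝ) ^ 2) i ν y')
          - triple (ksDH L a (msq / (L : ℝ) ^ 2) i μ x) (ksC L a (msq / (L : ℝ) ^ 2) i) (ksDH L a (msq / (L : ℝ) ^ 2) i ν y)|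
        ≤ Cr * θ ^ K * Real.exp (-(κ * Dsub)) := Hr (msq / (L : ℝ) ^ 2) hm2 hm2cap i μ ν x' y'
    have hexpS : Real.exp (-(κ * Dsub)) ≤ Real.exp κ * Real.exp (-(δ * (r' / (NK * L)))) :=
      exp_block_decay_le hNK1 hNKL hr'0 hδ.le hδκ hfine
    set E : ℝ := Real.exp (-(δ * (r' / (NK * L)))) with hEdef
    have hE0 : 0 ≤ E := (Real.exp_pos _).le
    have hS' : |triple (ksDH' L a (msq / (L : ℝ) ^ 2) i μ x') (ksC' L a (msq / (L : ℝ) ^ 2) i) (ksDH' L a (msq / (L : ℝ) ^ 2) i ν y')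
          - triple (ksDH L a (msq / (L : ℝ) ^ 2) i μ x) (ksC L a (msq / (L : ℝ) ^ 2) i) (ksDH L a (msq / (L : ℝ) ^ 2) i ν y)|
        ≤ Cr * Real.exp κ * θ ^ K * E := by
      calc _ ≤ Cr * θ ^ K * Real.exp (-(κ * Dsub)) := hS
        _ ≤ Cr * θ ^ K * (Real.exp κ * E) := mul_le_mul_of_nonneg_left hexpS (by positivity)
        _ = Cr * Real.exp κ * θ ^ K * E := by ring
    -- the pair of peels
    have hpeel := fullPropDD_peel_pair_abs_le L hL ha hmsq i μ ν x' y' x y h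
    -- the level sums of the target: paired `Σ_{j<K+1} = (j = 0) + Λ′·Σ_{j<K}(j ↦ j+1)`, unpaired `Λ·Σ`
    have hshiftP : ∀ j : ℕ, Λ' ^ (j + 1) * Real.exp (-(δ * (r' * (L : ℝ) ^ (j + 1) / (NK * L))))
        = Λ' * (Λ' ^ j * Real.exp (-(δ * (r' * (L : ℝ) ^ j / NK)))) := fun j => by
      have he : r' * (L : ℝ) ^ (j + 1) / (NK * L) = r' * (L : ℝ) ^ j / NK := by
        rw [pow_succ, ← mul_assoc, mul_div_mul_right _ _ hL0.ne']
      rw [he, pow_succ]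
      ring
    have hsumP : ∑ j ∈ Finset.range (K + 1), Λ' ^ j * Real.exp (-(δ * (r' * (L : ℝ) ^ j / (NK * L))))
        = E + Λ' * PS := by
      rw [Finset.sum_range_succ', pow_zero, pow_zero, one_mul, mul_one, hPSdef, Finset.mul_sum, add_comm]
      congr 1
      exact Finset.sum_congr rfl fun j _ => hshiftP j
    have hshiftU : ∀ j : ℕ, Λ ^ (K + 1 + j) * Real.exp (-(δ * (r' * (L : ℝ) ^ (K + 1 + j) / (NK * L))))
        = Λ * (Λ ^ (K + j) * Real.exp (-(δ * (r' * (L : ℝ) ^ (K + j) / NK)))) := fun j => by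
      have he : r' * (L : ℝ) ^ (K + j + 1) / (NK * L) = r' * (L : ℝ) ^ (K + j) / NK := by
        rw [pow_succ, ← mul_assoc, mul_div_mul_right _ _ hL0.ne']
      rw [show K + 1 + j = K + j + 1 by omega, he, pow_succ]
      ring
    have hsumU : ∑ j ∈ Finset.range n, Λ ^ (K + 1 + j) * Real.exp (-(δ * (r' * (L : ℝ) ^ (K + 1 + j) / (NK * L))))
        = Λ * US := by
      rw [hUSdef, Finset.mul_sum]
      exact Finset.sum_congr rfl fun j _ => hshiftU j
    -- the bookkeeping `θ^{K+1}·Λ′ = θ^K·Λ` and the spare power for the top slice `Λ·Cr·e^κ ≤ C·θ`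
    have hθpow : θ ^ (K + 1) * Λ' = θ ^ K * Λ := by rw [pow_succ, mul_assoc, hθΛ']
    have hCθ : Λ * Cr * Real.exp κ ≤ C * θ := hspare _ (by positivity) hC3
    -- the goal's distance and casts, on the right-hand side only (the casts also sit inside `G`'s arguments)
    conv_rhs => rw [tdistT_torCongr h, tdistT_flatten, hcastN, ← hr'def, hsumP, hsumU]
    refine (hpeel.trans (mul_le_mul_of_nonneg_left (add_le_add hIH hS') hΛ.le)).trans ?_
    calc Λ * (C * (θ ^ K * PS + US) + Cr * Real.exp κ * θ ^ K * E)
        = C * (θ ^ K * Λ) * PS + C * (Λ * US) + (Λ * Cr * Real.exp κ) * θ ^ K * E := by ring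
      _ ≤ C * (θ ^ K * Λ) * PS + C * (Λ * US) + (C * θ) * θ ^ K * E := by
          have := mul_le_mul_of_nonneg_right (mul_le_mul_of_nonneg_right hCθ (pow_nonneg hθ0.le K)) hE0
          linarith
      _ = C * (θ ^ (K + 1) * (E + Λ' * PS) + Λ * US) := by rw [← hθpow, pow_succ]; ring

end Summit.QuantumFields.YangMills.BalabanUVNodes.N15KingModelRung.Curved
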